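import Literature.MathematicalPhysics.QuantumFieldTheory.Balaban1983to89.B9CubeDirInverseBondCMemberRowsAtRecordY
import Literature.MathematicalPhysics.QuantumFieldTheory.Balaban1983to89.B9Eq360PadDeltaCubeYAgree
import Literature.MathematicalPhysics.QuantumFieldTheory.Balaban1983to89.B9CubeDirInverseKnitCubeLawsY

/-!
# `Balaban1983to89.B9CubeDirInverseBondCInsideAgreeY` — [Balaban1985BackgroundPropagators] p. 394 («restricted to Ω₀ with Dirichlet boundary conditions … They depend
# on the configuration U restricted to Ω₀»), (3.25)–(3.26) pp. 394–395, p. 409 l. 1–5: the Dirichlet SITE letter `G′_□(U)`, the projection letters `P_□ ∕ R_□ ∕ C_□ ∕ X_□` and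
# the COMPRESSED nonlocal part `𝟙_{Ω₀}·D_UP_□(U)D*_U·𝟙_{Ω₀}` of print's Dirichlet bond operator read `U` ONLY ON THE BONDS WITH BOTH ENDPOINTS IN `Ω₀(□)` — hence
# they coincide at the two cut small fields `cutCfgS Ω₀` and `cutCfgS T` (`T ⊇ Ω₀`) of road (B5) (LOCATED-35: the bond letter's local part needs the larger cut)

T. Bałaban, *Propagators for lattice gauge theories in a background field*, Commun. Math. Phys. **99** (1985) 389–434 [`Balaban1985BackgroundPropagators`, "B9"]
(held `paper:balaban1985-cmp99-background-propagators`; journal page = PDF page + 388).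

statement-level skeleton of published theorems with citation tags; proofs where landed; nothing here is a claim about the Yang–Mills mass gap

WHY THIS FILE (cell `pub-ymgap`, HUMAN RULING D-0062, node N06 [B9]; seat `pub-ymgap-dag-n06-d` g35, INTENT-9 — a letter-side input for dag-n06-c g34's road (B5) REST).
The supplier's (3.76)–(3.77) projection piece `hPP_dirC_cube₀` (✓`B9Cor35PDirCubeNoLegHyp`) is proved at the cut field `Ṽ₀ := cutCfgS i Ω₀(□) η A`, while the bond G-step
rows that inhabit the heads' `hRowsA` (✓«KE₂₀X-C») must be taken at `Ṽ := cutCfgS i T η A` with `T` one layer beyond the reading set (LOCATED-35: the hessian ∕ curvature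
part of `Δ_{loc,□}` reads the plaquette layer outside `Ω₀`).  The two cut fields agree exactly on the bonds with both endpoints in `Ω₀` (✓`UboxY_cutCfgS`).  The existing
congruences of this lineage (✓`B9CubeDirInverseKnitCubeLawsY.GpDirY_parKnitCubeY_congr_of_agree`, ✓`B9CubeDirInverseBondLocalityAtRecordY.PDirCubeY_congr_of_agree`,
✓`B9CubeDirInverseBondLocalityY.DPDsCubeDY_apply_congr`) ask agreement on ALL bond variables at the sites of `Ω₀` (also the bonds leaving or entering `Ω₀`), which the
two cuts do not have.  THIS FILE proves the sharper, INSIDE-ONLY versions and the resulting identity of the compressed projection word at the two cuts: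
* §1 ★ `qpLegAgreeY_parKnitCubeY_inside`, ★ `padDeltaCubeY_parKnitCubeY_congr_inside`, ★★ `GpDirY_parKnitCubeY_congr_inside`, `PDirCubeY_ ∕ RDirCubeY_ ∕ CDirCubeY_ ∕
  XDirCubeY_congr_inside` — from ONE hypothesis `∀ μ v, v ∈ Ω₀ → v + e_μ ∈ Ω₀ → Uᵤ(v) = U′ᵤ(v)` (n06-a's ✓`padDeltaCubeY_congr_of_agree_inside` + the level split of
  ✓`padDeltaCubeY_cutCfgS_eq_gaugeY`: positive-level `𝔅_□`-blocks lie inside `Ω₀` (✓`mem_dirDomY_of_one_le_levCubeY`), level-`0` knit legs are trivial);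
* §2 the REFINED pointwise readings `divY_apply_congr_tgt` (`(D*_UA)(z)` reads `U(b)` only on the bonds ENTERING `z`, transporter `gradT = 1` on the leaving ones) and
  `gradY_apply_congr_tgt` (`(D_Uφ)(b)` reads `U(b)` only against `φ(b₊)`), then ★★ `indProjY_DPDsDirCubeY_indProjY_congr_inside`:
  `𝟙_B·D_UP_□(U)D*_U·𝟙_B = 𝟙_B·D_{U′}P_□(U′)D*_{U′}·𝟙_B` (`B = bondsOverY Ω₀`) from inside agreement — the entering ∕ leaving bonds drop by the Dirichlet zero;
* §3 ★★★ `indProjY_DPDsDirCubeY_indProjY_cutCfgS_eq` (`Ω₀ ⊆ T` ⇒ the compressed word at `cutCfgS Ω₀ η A` = at `cutCfgS T η A`), `GpDirY_cutCfgS_eq_cutCfgS`,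
  `PDirCubeY_cutCfgS_eq_cutCfgS`, and the `conj b` form ★★ `conj_projWordDir_cutCfgS_eq` for the G-step's compressed `hPP`
  (`projK·conj b((D𝒫_□D*(Ṽ₀) − D𝒫_□D*(1))♯)·projK = projK·conj b((D𝒫_□D*(Ṽ) − D𝒫_□D*(1))♯)·projK`).

HONEST SCOPE ∕ NOT CLAIMED.  Locality bookkeeping over landed modules (0 `def`); no estimate; nothing of the G-step, the windows or the datum.  Count-neutral; N06 NOT discharged;
nothing on `d = 4`, the continuum, reflection positivity, the mass gap or Clay; YM mass gap NOT proved.  No `sorry`, no `axiom`, no `… : Prop` fact, no `instance`, no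
`notation`.  NEW file; nothing landed is modified.  `--supports stmt-QuantumFields-27239`.  Net new unproved facts: 0.

RELATED IN THE TREE, NOT DUPLICATED (searched 2026-08-31 20:1xZ: `rg` for the basename and the decl names over `lean/Literature/MathematicalPhysics` +
`lean/Summits/QuantumFields` — 0 hits): n06-a ✓`B9Eq360PadDeltaCubeYAgree` (`padDeltaCubeY_congr_of_agree_inside`, `padDeltaCubeY_cutCfgS_eq_gaugeY`,
`GpDirY_cutCfgS_eq_gaugeY` — the site letter at ONE cut vs the gauge field; §1 is its two-configuration form), ✓`B9CubeDirInverseKnitCubeLawsY` ∕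
✓`B9CubeDirInverseBondLocalityAtRecordY` ∕ ✓`B9CubeDirInverseBondLocalityY` (the cruder all-bonds congruences, USED for the pattern, not restated),
✓`B9Eq337CutFieldDirY.UboxY_cutCfgS` (the cut field's bond variables).
-/

noncomputable section

namespace Literature.MathematicalPhysics.QuantumFieldTheory.Balaban1983to89.B9CubeDirInverseBondCInsideAgreeY

open B9Eq352DivFormLetters (conj conj_mul conj_sub)
open B6KLevelCensusIndexV1 (KIdx)
open B6Cover236MultiLevelBlocks (cubes)
open B6GlobalChartV1 (PV boxEquiv)
open B6Geom246MultiLevelBoxL0 (blkOf)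
open B9Eq39Adjoint (fluct)
open B9Eq360DeltaPrimeAY (AfldY)
open B9CubeLettersOpsL0 (cubeFamY levCubeY avgTrCubeY)
open B9CubeLettersBondOpsL0 (BlkCubeY blkCornerCubeY)
open B9Thm311CubeLettersFirstThree (cornerY_levCubeY_eq levCubeY_eq_of_blkOf_eq)
open B9Eq359CubeKernelsKnitAtOne (avgTrCubeY_parKnitCubeY_congr_of_agree_block blkCubeY_eq_of_avgCoeffCubeY_ne_zero)
open B9Eq360PadDeltaCubeYAgree (padDeltaCubeY_congr_of_agree_inside knitCubeY_of_levCubeY_eq_zero)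
open B9Eq337CutFieldDirY (cutCfgS UboxY_cutCfgS)
open B9CubeDirInverseKnitCubeLawsY (mem_dirDomY_of_one_le_levCubeY)
open B9CubeDirInverseBondLocalityY (QpLegAgreeY PCubeDY_congr RCubeDY_congr CCubeDY_congr XinvCubeDY_congr XCubeGY_congr PCubeDY_comp_cubeProjY)
open B9CubeDirInverseBondLocalityAtRecordY (parKnitCubeY_corner_congr_of_agree_block)
open B9Cor35GpDirInputsAtOne (dirDomY)
open B9Cor35GCubeInputsAtOne (blkBK)
open B9Thm310CommutatorDataOfPlaquettes (UboxY_chartY)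
open Node00
open Node00.OpsYNablaBridge (chartY shiftY_chartY)
open Node00.OpsYLocalInverse (cubeProjY cubeProjY_apply)
open Node00.OpsYCubeDirInverse (padDeltaCubeY GpDirY GpDirY_def cubeProjY_mul_GpDirY GpDirY_mul_cubeProjY)
open Node00.OpsYCubeKnitPar (parKnitCubeY parKnitCubeY_apply parOfTL_corner_left knitCubeY)
open Node00.OpsYCubeProjectionG (insideBlkY PCubeDY RCubeDY CCubeDY XCubeGY XinvCubeDY DPDsCubeDY PDirCubeY RDirCubeY CDirCubeY XDirCubeY DPDsDirCubeY
  DPDsCubeDY_eq_gradY_PCubeDY_divY)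
open Node00.OpsYCubeDirInverseBond (indProjY indProjY_apply bondsOverY mem_bondsOverY)
open Node00.OpsYDeltaALocalAgree (trLiftY_apply_congr)

variable {d ℓ : ℕ} {hd : 1 ≤ d + 1} {hL : Odd (ℓ + 1) ∧ 1 < ℓ + 1} {b₀ b₁ : ℝ}
variable {𝔸 : Type} [NormedRing 𝔸] [NormedAlgebra ℂ 𝔸] [CompleteSpace 𝔸]

/-! ## §1  The site letter and the projection letters read `U` only on the bonds with both endpoints in `Ω₀(□)` -/

section Inside

variable (i : KIdx d ℓ hd hL b₀ b₁) (c : ↥(cubes (toKT i).D.toDomains)) {U U' : CfgY 𝔸 i}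

/-- ★ **THE CUBE KNIT LEGS INSIDE `Ω₀(□)` AGREE** when `U, U′` agree on the bonds with both endpoints in `Ω₀(□)`: a positive-level `𝔅_□`-block lies inside `Ω₀(□)`
(✓`mem_dirDomY_of_one_le_levCubeY`) and its knit paths stay in the block; a level-`0` leg is trivial. [cite: Balaban1985BackgroundPropagators, (3.19) p.393, p.394 («restricted to Ω₀»), p.409 l.1–5] -/
theorem qpLegAgreeY_parKnitCubeY_inside (hin : ∀ (μ : Fin (d + 1)) (v : SiteY i), v ∈ dirDomY i c → shiftY i μ v ∈ dirDomY i c → UboxY i U μ v = UboxY i U' μ v) :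
    QpLegAgreeY i c (parKnitCubeY i c) (dirDomY i c) U U' := by
  intro z _ s hs
  rcases Nat.eq_zero_or_pos (levCubeY i c z) with h0 | hpos
  · have hc : cornerY i (levCubeY i c z) z = blkCornerCubeY i c s := by rw [cornerY_levCubeY_eq i c z]; exact congrArg _ hs
    rw [parKnitCubeY_apply, parKnitCubeY_apply, ← hc, parOfTL_corner_left, parOfTL_corner_left]
    exact (knitCubeY_of_levCubeY_eq_zero i c U h0).trans (knitCubeY_of_levCubeY_eq_zero i c U' h0).symm
  · exact parKnitCubeY_corner_congr_of_agree_block i c hs fun v μ hv hv' =>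
      hin μ v (mem_dirDomY_of_one_le_levCubeY i c (by rw [levCubeY_eq_of_blkOf_eq i c (hv.trans hs.symm)]; exact hpos))
        (mem_dirDomY_of_one_le_levCubeY i c (by rw [levCubeY_eq_of_blkOf_eq i c (hv'.trans hs.symm)]; exact hpos))

/-- ★ **`padΔ_{□,Ω₀}(U) = padΔ_{□,Ω₀}(U′)` AT THE CUBE KNIT LEGS FROM INSIDE AGREEMENT** (n06-a's ✓`padDeltaCubeY_congr_of_agree_inside`, two-configuration form: the
Laplacian rows between sites of `Ω₀` read inside bonds; the averaging pairs of a positive-level block read the block's bonds, inside `Ω₀`; level `0` is trivial).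
[cite: Balaban1985BackgroundPropagators, p.394 («Ω₀Δ′_aΩ₀ … They depend on the configuration U restricted to Ω₀»), (3.19) p.393, p.409 l.1–5] -/
theorem padDeltaCubeY_parKnitCubeY_congr_inside
    (hin : ∀ (μ : Fin (d + 1)) (v : SiteY i), v ∈ dirDomY i c → shiftY i μ v ∈ dirDomY i c → UboxY i U μ v = UboxY i U' μ v) :
    padDeltaCubeY i c (parKnitCubeY i c) (dirDomY i c) U = padDeltaCubeY i c (parKnitCubeY i c) (dirDomY i c) U' := by
  refine padDeltaCubeY_congr_of_agree_inside i c (parKnitCubeY i c) (dirDomY i c) (fun z hz μ hz' => hin μ z hz hz')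
    (fun z hz μ hz' => hin μ _ hz' (by rw [Equiv.apply_symm_apply]; exact hz)) fun z hz w hzw hw => ?_
  rcases Nat.eq_zero_or_pos (levCubeY i c z) with h0 | hpos
  · have hb := blkCubeY_eq_of_avgCoeffCubeY_ne_zero i c hzw
    have hw0 : levCubeY i c w = 0 := (levCubeY_eq_of_blkOf_eq i c hb).trans h0
    rw [Node00.OpsYCubeKnitPar.avgTrCubeY_parKnitCubeY i c _ hzw, Node00.OpsYCubeKnitPar.avgTrCubeY_parKnitCubeY i c _ hzw,
      knitCubeY_of_levCubeY_eq_zero i c _ h0, knitCubeY_of_levCubeY_eq_zero i c _ h0, knitCubeY_of_levCubeY_eq_zero i c _ hw0,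
      knitCubeY_of_levCubeY_eq_zero i c _ hw0]
  · refine avgTrCubeY_parKnitCubeY_congr_of_agree_block i c hzw fun v μ hv hv' => ?_
    exact hin μ v (mem_dirDomY_of_one_le_levCubeY i c (by rw [levCubeY_eq_of_blkOf_eq i c hv]; exact hpos))
      (mem_dirDomY_of_one_le_levCubeY i c (by rw [levCubeY_eq_of_blkOf_eq i c hv']; exact hpos))

/-- ★★ **`G′_□(U) = G′_□(U′)` FROM INSIDE AGREEMENT** — print's Dirichlet site letter of the cube sequence reads `U` only on the bonds with both endpoints in `Ω₀(□)`.
[cite: Balaban1985BackgroundPropagators, p.394 («They depend on the configuration U restricted to Ω₀»), p.409 l.1–5] -/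
theorem GpDirY_parKnitCubeY_congr_inside
    (hin : ∀ (μ : Fin (d + 1)) (v : SiteY i), v ∈ dirDomY i c → shiftY i μ v ∈ dirDomY i c → UboxY i U μ v = UboxY i U' μ v) :
    GpDirY i c (parKnitCubeY i c) (dirDomY i c) U = GpDirY i c (parKnitCubeY i c) (dirDomY i c) U' := by
  rw [GpDirY_def, GpDirY_def, padDeltaCubeY_parKnitCubeY_congr_inside i c hin]

/-- ★ `P_□(U) = P_□(U′)` from inside agreement. [cite: Balaban1985BackgroundPropagators, (3.25) p.394, p.409 l.1–5] -/
theorem PDirCubeY_congr_inside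
    (hin : ∀ (μ : Fin (d + 1)) (v : SiteY i), v ∈ dirDomY i c → shiftY i μ v ∈ dirDomY i c → UboxY i U μ v = UboxY i U' μ v) :
    PDirCubeY i c (dirDomY i c) U = PDirCubeY i c (dirDomY i c) U' :=
  PCubeDY_congr (insideBlkY i c (dirDomY i c)) (GpDirY_parKnitCubeY_congr_inside i c hin) (cubeProjY_mul_GpDirY i c _ _ U') (GpDirY_mul_cubeProjY i c _ _ U')
    (qpLegAgreeY_parKnitCubeY_inside i c hin)

/-- `R_□(U) = R_□(U′)` from inside agreement. [cite: Balaban1985BackgroundPropagators, (3.25) p.394, p.409 l.1–5] -/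
theorem RDirCubeY_congr_inside
    (hin : ∀ (μ : Fin (d + 1)) (v : SiteY i), v ∈ dirDomY i c → shiftY i μ v ∈ dirDomY i c → UboxY i U μ v = UboxY i U' μ v) :
    RDirCubeY i c (dirDomY i c) U = RDirCubeY i c (dirDomY i c) U' :=
  RCubeDY_congr (insideBlkY i c (dirDomY i c)) (GpDirY_parKnitCubeY_congr_inside i c hin) (cubeProjY_mul_GpDirY i c _ _ U') (GpDirY_mul_cubeProjY i c _ _ U')
    (qpLegAgreeY_parKnitCubeY_inside i c hin)

/-- `C_□(U) = C_□(U′)` from inside agreement. [cite: Balaban1985BackgroundPropagators, (3.48) p.398, p.409 l.1–5] -/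
theorem CDirCubeY_congr_inside
    (hin : ∀ (μ : Fin (d + 1)) (v : SiteY i), v ∈ dirDomY i c → shiftY i μ v ∈ dirDomY i c → UboxY i U μ v = UboxY i U' μ v) :
    CDirCubeY i c (dirDomY i c) U = CDirCubeY i c (dirDomY i c) U' :=
  CCubeDY_congr (insideBlkY i c (dirDomY i c)) (GpDirY_parKnitCubeY_congr_inside i c hin) (cubeProjY_mul_GpDirY i c _ _ U') (GpDirY_mul_cubeProjY i c _ _ U')
    (qpLegAgreeY_parKnitCubeY_inside i c hin)

/-- `X_□(U) = X_□(U′)` from inside agreement. [cite: Balaban1985BackgroundPropagators, (3.25) p.394, p.409 l.1–5] -/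
theorem XDirCubeY_congr_inside
    (hin : ∀ (μ : Fin (d + 1)) (v : SiteY i), v ∈ dirDomY i c → shiftY i μ v ∈ dirDomY i c → UboxY i U μ v = UboxY i U' μ v) :
    XDirCubeY i c (dirDomY i c) U = XDirCubeY i c (dirDomY i c) U' :=
  XCubeGY_congr (GpDirY_parKnitCubeY_congr_inside i c hin) (cubeProjY_mul_GpDirY i c _ _ U') (GpDirY_mul_cubeProjY i c _ _ U')
    (qpLegAgreeY_parKnitCubeY_inside i c hin)

end Inside

/-! ## §2  The compressed nonlocal part `𝟙_B·D_UP_□(U)D*_U·𝟙_B` from inside agreement -/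

section Compressed

variable (i : KIdx d ℓ hd hL b₀ b₁)

/-- `(D*_UA)(z)` reads `U(b)` only at the bonds of its row ENTERING `z` (`b₊ = z`) where `A(b) ≠ 0` — the transporter of a leaving bond is `1` (def-Y's `gradT`).
[cite: Balaban1985BackgroundPropagators, (3.8) p.392] -/
theorem divY_apply_congr_tgt {U U' : CfgY 𝔸 i} {z : SiteY i} {Λ : FBondY i → 𝔸}
    (h : ∀ b : FBondY i, divK i z b ≠ 0 → Λ b ≠ 0 → z = boxEquiv i.hN b.tgt → U b.dir b.src = U' b.dir b.src) : divY i U Λ z = divY i U' Λ z := by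
  refine trLiftY_apply_congr fun b hb => ⟨rfl, fun hΛ => ?_⟩
  by_cases hz : z = boxEquiv i.hN b.tgt
  · simp only [gradT, if_pos hz, h b hb hΛ hz]
  · simp only [gradT, if_neg hz]

/-- `(D_Uφ)(b)` reads `U(b)` only against `φ(b₊)`. [cite: Balaban1985BackgroundPropagators, (3.3) p.390] -/
theorem gradY_apply_congr_tgt {U U' : CfgY 𝔸 i} {b : FBondY i} {Φ : SiteY i → 𝔸} (h : Φ (chartY i b.tgt) ≠ 0 → U b.dir b.src = U' b.dir b.src) :
    gradY i U Φ b = gradY i U' Φ b := by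
  refine trLiftY_apply_congr fun z hz => ⟨rfl, fun hΦ => ?_⟩
  by_cases hzt : z = boxEquiv i.hN b.tgt
  · simp only [gradT, if_pos hzt, h (hzt ▸ hΦ)]
  · simp only [gradT, if_neg hzt]

variable (c : ↥(cubes (toKT i).D.toDomains)) {U U' : CfgY 𝔸 i}

/-- ★★ **THE COMPRESSED NONLOCAL PART READS `U` ONLY INSIDE `Ω₀(□)`**: `𝟙_B·D_UP_□(U)D*_U·𝟙_B = 𝟙_B·D_{U′}P_□(U′)D*_{U′}·𝟙_B` for `B = bondsOverY Ω₀(□)` whenever `U, U′`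
agree on the bonds with both endpoints in `Ω₀(□)` — `P_□` by §1; in `D*_U(𝟙_BA)` at a site of `Ω₀` only bonds entering from `Ω₀` carry a transporter; in `(D_Uφ)(b)` at a bond
over `Ω₀` the transporter multiplies `φ(b₊)`, which vanishes unless `b₊ ∈ Ω₀` (`φ = P_□(…)` is supported in `Ω₀`: `Ω₀·G′_□ = G′_□`).
[cite: Balaban1985BackgroundPropagators, (3.26) p.395, p.394 («restricted to Ω₀ with Dirichlet boundary conditions»), (3.105) p.414, p.409 l.1–5] -/
theorem indProjY_DPDsDirCubeY_indProjY_congr_inside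
    (hin : ∀ (μ : Fin (d + 1)) (v : SiteY i), v ∈ dirDomY i c → shiftY i μ v ∈ dirDomY i c → UboxY i U μ v = UboxY i U' μ v) :
    indProjY (bondsOverY i (dirDomY i c)) * DPDsDirCubeY i c (dirDomY i c) U * indProjY (bondsOverY i (dirDomY i c)) =
      indProjY (bondsOverY i (dirDomY i c)) * DPDsDirCubeY i c (dirDomY i c) U' * indProjY (bondsOverY i (dirDomY i c)) := by
  classical
  set S := dirDomY i c with hS
  -- raw-coordinate form of the inside agreement
  have hraw : ∀ b : FBondY i, chartY i b.src ∈ S → chartY i b.tgt ∈ S → U b.dir b.src = U' b.dir b.src := fun b hs ht => by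
    have e := hin b.dir (chartY i b.src) hs (by rw [shiftY_chartY]; exact ht)
    rwa [UboxY_chartY, UboxY_chartY] at e
  refine LinearMap.ext fun A => funext fun b => ?_
  simp only [Module.End.mul_apply, indProjY_apply]
  split_ifs with hb
  · have hbS : chartY i b.src ∈ S := (mem_bondsOverY i).1 hb
    set A' : FBondY i → 𝔸 := indProjY (bondsOverY i S) A with hA'
    have hA'S : ∀ b', A' b' ≠ 0 → chartY i b'.src ∈ S := fun b' hb' => by
      by_contra hns
      exact hb' (by rw [hA', indProjY_apply, if_neg (mt (mem_bondsOverY i).1 hns)])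
    show DPDsDirCubeY i c S U A' b = DPDsDirCubeY i c S U' A' b
    rw [show DPDsDirCubeY i c S U = gradY i U ∘ₗ PDirCubeY i c S U ∘ₗ divY i U from DPDsCubeDY_eq_gradY_PCubeDY_divY i c _ _ _ U,
      show DPDsDirCubeY i c S U' = gradY i U' ∘ₗ PDirCubeY i c S U' ∘ₗ divY i U' from DPDsCubeDY_eq_gradY_PCubeDY_divY i c _ _ _ U']
    simp only [LinearMap.coe_comp, Function.comp_apply]
    have hP : PDirCubeY i c S U = PDirCubeY i c S U' := PDirCubeY_congr_inside i c hin
    -- `D*`: only entering bonds with both endpoints in `Ω₀` carry `U`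
    have hdiv : cubeProjY (𝔸 := 𝔸) i S (divY i U A') = cubeProjY i S (divY i U' A') := by
      refine funext fun z => ?_
      rw [cubeProjY_apply, cubeProjY_apply]
      split_ifs with hz
      · exact divY_apply_congr_tgt i fun b' _ hb' hzt => hraw b' (hA'S b' hb') (hzt ▸ hz)
      · rfl
    have hPr : GpDirY i c (parKnitCubeY i c) S U' * cubeProjY i S = GpDirY i c (parKnitCubeY i c) S U' := GpDirY_mul_cubeProjY i c _ S U'
    have hmid : PDirCubeY i c S U (divY i U A') = PDirCubeY i c S U' (divY i U' A') := by
      rw [hP]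
      have hc := PCubeDY_comp_cubeProjY (parS := parKnitCubeY i c) (insideBlkY i c S) hPr
      show PCubeDY i c (parKnitCubeY i c) (GpDirY i c (parKnitCubeY i c) S) (insideBlkY i c S) U' (divY i U A') =
        PCubeDY i c (parKnitCubeY i c) (GpDirY i c (parKnitCubeY i c) S) (insideBlkY i c S) U' (divY i U' A')
      rw [← hc, LinearMap.comp_apply, LinearMap.comp_apply, hdiv]
    rw [hmid]
    -- `D`: the transporter of `b` multiplies `φ(b₊)`, and `φ = P_□(U′)(…)` is supported in `Ω₀`
    refine gradY_apply_congr_tgt i fun hΦ => hraw b hbS ?_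
    by_contra hnt
    apply hΦ
    have hΦS : ∀ ψ : SiteY i → 𝔸, cubeProjY i S (PDirCubeY i c S U' ψ) = PDirCubeY i c S U' ψ := fun ψ => by
      show cubeProjY i S (GpDirY i c (parKnitCubeY i c) S U' _) = GpDirY i c (parKnitCubeY i c) S U' _
      rw [← Module.End.mul_apply, cubeProjY_mul_GpDirY]
    have e := congrFun (hΦS (divY i U' A')) (chartY i b.tgt)
    rw [cubeProjY_apply, if_neg hnt] at e
    exact e.symm
  · rfl

end Compressed

/-! ## §3  At the two cut small fields of road (B5): `cutCfgS Ω₀` and `cutCfgS T`, `T ⊇ Ω₀` -/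

section Cuts

variable (i : KIdx d ℓ hd hL b₀ b₁) (c : ↥(cubes (toKT i).D.toDomains))

/-- the two cut fields have the same bond variables on the bonds with both endpoints in `Ω₀ ⊆ T`. [cite: Balaban1985BackgroundPropagators, p.408 («U′ = Uᵘ = e^{iηA}»), p.394] -/
theorem UboxY_cutCfgS_eq_of_subset {T : Finset (SiteY i)} (hT : dirDomY i c ⊆ T) (η : ℝ) (A : AfldY 𝔸 i) :
    ∀ (μ : Fin (d + 1)) (v : SiteY i), v ∈ dirDomY i c → shiftY i μ v ∈ dirDomY i c →
      UboxY i (cutCfgS i (dirDomY i c) η A) μ v = UboxY i (cutCfgS i T η A) μ v := fun μ v hv hv' => by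
  rw [UboxY_cutCfgS, UboxY_cutCfgS, if_pos ⟨hv, hv'⟩, if_pos ⟨hT hv, hT hv'⟩]

/-- ★ `G′_□` at the two cuts. [cite: Balaban1985BackgroundPropagators, p.394, p.409 l.1–5] -/
theorem GpDirY_cutCfgS_eq_cutCfgS {T : Finset (SiteY i)} (hT : dirDomY i c ⊆ T) (η : ℝ) (A : AfldY 𝔸 i) :
    GpDirY i c (parKnitCubeY i c) (dirDomY i c) (cutCfgS i (dirDomY i c) η A) = GpDirY i c (parKnitCubeY i c) (dirDomY i c) (cutCfgS i T η A) :=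
  GpDirY_parKnitCubeY_congr_inside i c (UboxY_cutCfgS_eq_of_subset i c hT η A)

/-- ★ `P_□` at the two cuts. [cite: Balaban1985BackgroundPropagators, (3.25) p.394, p.409 l.1–5] -/
theorem PDirCubeY_cutCfgS_eq_cutCfgS {T : Finset (SiteY i)} (hT : dirDomY i c ⊆ T) (η : ℝ) (A : AfldY 𝔸 i) :
    PDirCubeY i c (dirDomY i c) (cutCfgS i (dirDomY i c) η A) = PDirCubeY i c (dirDomY i c) (cutCfgS i T η A) :=
  PDirCubeY_congr_inside i c (UboxY_cutCfgS_eq_of_subset i c hT η A)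

/-- ★★★ **THE COMPRESSED NONLOCAL PART AT THE TWO CUTS**: `𝟙_B·D𝒫_□D*(cutCfgS Ω₀ η A)·𝟙_B = 𝟙_B·D𝒫_□D*(cutCfgS T η A)·𝟙_B` for `Ω₀ ⊆ T` — so the supplier's projection piece
proved at the `Ω₀`-cut serves the bond G-step at the `T`-cut once compressed (LOCATED-35). [cite: Balaban1985BackgroundPropagators, (3.26) p.395, (3.76)–(3.77) p.406, (3.85) p.407, p.409 l.1–5] -/
theorem indProjY_DPDsDirCubeY_indProjY_cutCfgS_eq {T : Finset (SiteY i)} (hT : dirDomY i c ⊆ T) (η : ℝ) (A : AfldY 𝔸 i) :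
    indProjY (bondsOverY i (dirDomY i c)) * DPDsDirCubeY i c (dirDomY i c) (cutCfgS i (dirDomY i c) η A) * indProjY (bondsOverY i (dirDomY i c)) =
      indProjY (bondsOverY i (dirDomY i c)) * DPDsDirCubeY i c (dirDomY i c) (cutCfgS i T η A) * indProjY (bondsOverY i (dirDomY i c)) :=
  indProjY_DPDsDirCubeY_indProjY_congr_inside i c (UboxY_cutCfgS_eq_of_subset i c hT η A)

variable {ι : Type} [Fintype ι] (b : Module.Basis ι ℝ 𝔸)

omit [CompleteSpace 𝔸] in
/-- `𝟙♯·conj b(X♯)·𝟙♯ = conj b((𝟙X𝟙)♯)`. [cite: Balaban1984PropagatorsII, (2.52) p.232 (compositions), bookkeeping] -/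
theorem conj_indProjY_mul_mul_indProjY (B : Finset (FBondY i)) (X : Module.End ℂ (FBondY i → 𝔸)) :
    conj b ((indProjY (𝔸 := 𝔸) B).restrictScalars ℝ) * conj b (X.restrictScalars ℝ) * conj b ((indProjY (𝔸 := 𝔸) B).restrictScalars ℝ) =
      conj b ((indProjY B * X * indProjY B).restrictScalars ℝ) := by
  rw [← B9Eq352DivFormLetters.conj_mul, ← B9Eq352DivFormLetters.conj_mul]; rfl

/-- ★★ **THE G-STEP's COMPRESSED PROJECTION PIECE AT THE TWO CUTS** (the shape ✓`cor35_GDir_rows_of_pieces` uses through `VdK = projK·conj b((T1 − TṼ)♯)·projK`):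
`conj b(𝟙♯)·conj b((D𝒫_□D*(Ṽ₀) − D𝒫_□D*(1))♯)·conj b(𝟙♯) = conj b(𝟙♯)·conj b((D𝒫_□D*(Ṽ) − D𝒫_□D*(1))♯)·conj b(𝟙♯)` for `Ṽ₀ = cutCfgS Ω₀ η A`, `Ṽ = cutCfgS T η A`, `Ω₀ ⊆ T`.
[cite: Balaban1985BackgroundPropagators, (3.76)–(3.77) p.406, (3.85) p.407, p.409 l.1–5] -/
theorem conj_projWordDir_cutCfgS_eq {T : Finset (SiteY i)} (hT : dirDomY i c ⊆ T) (η : ℝ) (A : AfldY 𝔸 i) :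
    conj b ((indProjY (𝔸 := 𝔸) (bondsOverY i (dirDomY i c))).restrictScalars ℝ) *
        conj b ((DPDsDirCubeY i c (dirDomY i c) (cutCfgS i (dirDomY i c) η A) - DPDsDirCubeY i c (dirDomY i c) (fun _ _ => 1)).restrictScalars ℝ) *
        conj b ((indProjY (𝔸 := 𝔸) (bondsOverY i (dirDomY i c))).restrictScalars ℝ) =
      conj b ((indProjY (𝔸 := 𝔸) (bondsOverY i (dirDomY i c))).restrictScalars ℝ) *
        conj b ((DPDsDirCubeY i c (dirDomY i c) (cutCfgS i T η A) - DPDsDirCubeY i c (dirDomY i c) (fun _ _ => 1)).restrictScalars ℝ) *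
        conj b ((indProjY (𝔸 := 𝔸) (bondsOverY i (dirDomY i c))).restrictScalars ℝ) := by
  rw [conj_indProjY_mul_mul_indProjY, conj_indProjY_mul_mul_indProjY, mul_sub, sub_mul, mul_sub, sub_mul,
    indProjY_DPDsDirCubeY_indProjY_cutCfgS_eq i c hT η A]

end Cuts

end Literature.MathematicalPhysics.QuantumFieldTheory.Balaban1983to89.B9CubeDirInverseBondCInsideAgreeY

end
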